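import Mathlib
import Literature.Probability.RandomGraphs.LowDegree
import Literature.NumberTheory.LFunctions.LiouvilleSumClassicalBound
import HarnessLib

/-!
# Crux `MobiusLadder.LiouvilleOrthogonalTC0` (stmt-QuantumAdvantage-1393), line `Sketch`, skeleton v9:
stub `stub_topDigits` (T2) — `λ` is orthogonal to every Boolean function of the top digits

Let `ψ : ℕ → ℕ` be non-decreasing and unbounded. Then for every `ε > 0`, eventually in `n`, for
EVERY `G : ℕ → Bool`, `|Σ_{N < 2ⁿ} λ(N) · sgn G(⌊N / 2^{ψ n}⌋)| ≤ ε 2ⁿ`: the Liouville function is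
orthogonal, uniformly in `G`, to every `±1`-valued function of the binary digits of `N` above
position `ψ(n)`.

Proof (dyadic assembly of the aligned-blocks hypothesis `hBlocks`, the landed neighbour
`stub_alignedBlocks`: for a scale `s j ≤ j`, `s j → ∞`, eventually in `j` the `2^{j - s j}` aligned
blocks `B_i = [2^j + i 2^{s j}, 2^j + (i + 1) 2^{s j})` tiling `[2^j, 2^{j+1})` have
`Σ_i |Σ_{B_i} λ| ≤ η 2^j`). Fix `ε > 0`, pick `L` with `2^{-L} < ε/4` and apply `hBlocks` to the
scale `s j = min (ψ j) j` with `η = ε/2`, valid for `j ≥ j₀`. For `n ≥ j₀ + L` split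
`[0, 2ⁿ) = [0, 2^{n-L}) ∪ ⋃_{n-L ≤ j < n} [2^j, 2^{j+1})`. The low part has at most
`2^{n-L} ≤ (ε/4) 2ⁿ` terms of modulus `≤ 1`. On generation `j` (`j₀ ≤ j ≤ n`), tile
`[2^j, 2^{j+1})` by the blocks `B_i`
of length `2^t`, `t = s j ≤ ψ j ≤ ψ n`; on each block `⌊N / 2^{ψ n}⌋` is constant
(`topDigits_div_const`), so the block contributes `|Σ_{B_i} λ|`, and the generation contributes at
most `(ε/2) 2^j`; summing the geometric series, the high part is at most `(ε/2) 2ⁿ`.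
-/

set_option linter.dupNamespace false -- D-0017: single-problem summit ⇒ `QuantumAdvantage.QuantumAdvantage` by design

noncomputable section

namespace Summit.QuantumAdvantage.QuantumAdvantage.Theorems.LiouvilleOrthogonalTC0

open Filter Finset
open Literature.Probability.RandomGraphs.LowDegree (sgn)
open Literature.NumberTheory.LFunctions.LiouvilleSum (abs_liouville_le_one)

/-- Dyadic decomposition `Σ_{N ∈ [2^a, 2^b)} F N = Σ_{a ≤ j < b} Σ_{N ∈ [2^j, 2^{j+1})} F N`. -/
theorem topDigits_sum_dyadic (F : ℕ → ℝ) {a b : ℕ} (hab : a ≤ b) :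
    ∑ N ∈ Ico (2 ^ a) (2 ^ b), F N = ∑ j ∈ Ico a b, ∑ N ∈ Ico (2 ^ j) (2 ^ (j + 1)), F N := by
  induction b, hab using Nat.le_induction with
  | base => simp
  | succ b hab ih =>
    rw [Finset.sum_Ico_succ_top hab, ← ih, Finset.sum_Ico_consecutive]
    · exact Nat.pow_le_pow_right two_pos hab
    · exact Nat.pow_le_pow_right two_pos (Nat.le_succ b)

/-- Block decomposition
`Σ_{N ∈ [X, X + M H)} F N = Σ_{i < M} Σ_{N ∈ [X + i H, X + (i+1) H)} F N`. -/
theorem topDigits_sum_blocks (F : ℕ → ℝ) (X H M : ℕ) :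
    ∑ N ∈ Ico X (X + M * H), F N
      = ∑ i ∈ range M, ∑ N ∈ Ico (X + i * H) (X + (i + 1) * H), F N := by
  induction M with
  | zero => simp
  | succ M ih =>
    rw [Finset.sum_range_succ, ← ih, Finset.sum_Ico_consecutive]
    · exact Nat.le_add_right _ _
    · exact Nat.add_le_add_left (Nat.mul_le_mul_right _ (Nat.le_succ M)) _

/-- Geometric sum `Σ_{a ≤ j < b} 2^j = 2^b - 2^a`. -/
theorem topDigits_geom {a b : ℕ} (hab : a ≤ b) :
    ∑ j ∈ Ico a b, (2 : ℝ) ^ j = 2 ^ b - 2 ^ a := by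
  induction b, hab using Nat.le_induction with
  | base => simp
  | succ b hab ih => rw [Finset.sum_Ico_succ_top hab, ih, pow_succ]; ring

/-- KEY FACT: on an aligned block `[2^j + i 2^t, 2^j + (i+1) 2^t)` with `t ≤ j`, `t ≤ T`, the top
digits `⌊N / 2^T⌋` are constant, namely `⌊(2^{j-t} + i) / 2^{T-t}⌋`. -/
theorem topDigits_div_const {j t T i N : ℕ} (htj : t ≤ j) (htT : t ≤ T)
    (h1 : 2 ^ j + i * 2 ^ t ≤ N) (h2 : N < 2 ^ j + (i + 1) * 2 ^ t) :
    N / 2 ^ T = (2 ^ (j - t) + i) / 2 ^ (T - t) := by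
  have hj : 2 ^ j = 2 ^ (j - t) * 2 ^ t := by rw [← pow_add, Nat.sub_add_cancel htj]
  have hN : N / 2 ^ t = 2 ^ (j - t) + i := by
    apply Nat.div_eq_of_lt_le
    · calc (2 ^ (j - t) + i) * 2 ^ t = 2 ^ j + i * 2 ^ t := by rw [hj]; ring
        _ ≤ N := h1
    · calc N < 2 ^ j + (i + 1) * 2 ^ t := h2
        _ = (2 ^ (j - t) + i + 1) * 2 ^ t := by rw [hj]; ring
  rw [← hN, Nat.div_div_eq_div_mul, ← pow_add, Nat.add_sub_of_le htT]

/-- One aligned block: since `⌊N / 2^T⌋` is constant on `[2^j + i 2^t, 2^j + (i+1) 2^t)`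
(`t ≤ j`, `t ≤ T`), the twisted block sum has the modulus of the plain block sum of `λ`. -/
theorem topDigits_block (G : ℕ → Bool) {j t T : ℕ} (htj : t ≤ j) (htT : t ≤ T) (i : ℕ) :
    |∑ N ∈ Ico (2 ^ j + i * 2 ^ t) (2 ^ j + (i + 1) * 2 ^ t),
        ((ArithmeticFunction.liouville N : ℤ) : ℝ) * sgn (G (N / 2 ^ T))|
      = |∑ N ∈ Ico (2 ^ j + i * 2 ^ t) (2 ^ j + (i + 1) * 2 ^ t),
          ((ArithmeticFunction.liouville N : ℤ) : ℝ)| := by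
  have h : ∀ N ∈ Ico (2 ^ j + i * 2 ^ t) (2 ^ j + (i + 1) * 2 ^ t),
      ((ArithmeticFunction.liouville N : ℤ) : ℝ) * sgn (G (N / 2 ^ T))
        = ((ArithmeticFunction.liouville N : ℤ) : ℝ)
          * sgn (G ((2 ^ (j - t) + i) / 2 ^ (T - t))) := by
    intro N hN
    rw [Finset.mem_Ico] at hN
    rw [topDigits_div_const htj htT hN.1 hN.2]
  have hsgn : ∀ b : Bool, |sgn b| = 1 := fun b => by cases b <;> simp [sgn]
  rw [Finset.sum_congr rfl h, ← Finset.sum_mul, abs_mul, hsgn, mul_one]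

/-- One dyadic generation: if the aligned blocks of length `2^t` (`t ≤ j`, `t ≤ T`) tiling
`[2^j, 2^{j+1})` satisfy `Σ_i |Σ_{B_i} λ| ≤ η 2^j`, then
`|Σ_{N ∈ [2^j, 2^{j+1})} λ(N) sgn G(⌊N/2^T⌋)| ≤ η 2^j`. -/
theorem topDigits_generation (G : ℕ → Bool) {j t T : ℕ} (htj : t ≤ j) (htT : t ≤ T) {η : ℝ}
    (hB : (∑ i ∈ range (2 ^ (j - t)),
        |∑ N ∈ Ico (2 ^ j + i * 2 ^ t) (2 ^ j + (i + 1) * 2 ^ t),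
          ((ArithmeticFunction.liouville N : ℤ) : ℝ)|) ≤ η * 2 ^ j) :
    |∑ N ∈ Ico (2 ^ j) (2 ^ (j + 1)),
        ((ArithmeticFunction.liouville N : ℤ) : ℝ) * sgn (G (N / 2 ^ T))| ≤ η * 2 ^ j := by
  have hsplit : 2 ^ (j + 1) = 2 ^ j + 2 ^ (j - t) * 2 ^ t := by
    rw [← pow_add, Nat.sub_add_cancel htj, pow_succ]; ring
  rw [hsplit, topDigits_sum_blocks]
  calc |∑ i ∈ range (2 ^ (j - t)), ∑ N ∈ Ico (2 ^ j + i * 2 ^ t) (2 ^ j + (i + 1) * 2 ^ t),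
          ((ArithmeticFunction.liouville N : ℤ) : ℝ) * sgn (G (N / 2 ^ T))|
      ≤ ∑ i ∈ range (2 ^ (j - t)), |∑ N ∈ Ico (2 ^ j + i * 2 ^ t) (2 ^ j + (i + 1) * 2 ^ t),
          ((ArithmeticFunction.liouville N : ℤ) : ℝ) * sgn (G (N / 2 ^ T))| :=
        Finset.abs_sum_le_sum_abs _ _
    _ = ∑ i ∈ range (2 ^ (j - t)), |∑ N ∈ Ico (2 ^ j + i * 2 ^ t) (2 ^ j + (i + 1) * 2 ^ t),
          ((ArithmeticFunction.liouville N : ℤ) : ℝ)| :=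
        Finset.sum_congr rfl fun i _ => topDigits_block G htj htT i
    _ ≤ η * 2 ^ j := hB

/-- `min` of a function tending to `+∞` with the identity tends to `+∞`. -/
theorem topDigits_tendsto_min {ψ : ℕ → ℕ} (hψ' : Tendsto ψ atTop atTop) :
    Tendsto (fun j => min (ψ j) j) atTop atTop := by
  rw [Filter.tendsto_atTop] at hψ' ⊢
  exact fun b => ((hψ' b).and (Filter.eventually_ge_atTop b)).mono fun t ht => le_min ht.1 ht.2

/-- **Stub `stub_topDigits` (line `Sketch`, v9, T2) — `λ` is orthogonal to every Boolean function
of the top digits.** For `ψ` non-decreasing and unbounded and every `ε > 0`: eventually in `n`,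
for every `G : ℕ → Bool`, `|Σ_{N < 2ⁿ} λ(N) sgn G(⌊N / 2^{ψ n}⌋)| ≤ ε 2ⁿ`. Dyadic assembly of the
aligned-blocks hypothesis `hBlocks` (the landed neighbour `stub_alignedBlocks`, Matomäki–Radziwiłł
on aligned blocks) at the scale `s j = min (ψ j) j`: the `2^{n-L}` lowest `N` are bounded
trivially, and on each aligned block of generation `j ∈ [n - L, n)` the top digits are constant
(`topDigits_generation`). -/
theorem stub_topDigits
    (hBlocks : ∀ s : ℕ → ℕ, (∀ j, s j ≤ j) → Tendsto s atTop atTop → ∀ η : ℝ, 0 < η →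
      ∀ᶠ j : ℕ in atTop,
        (∑ i ∈ Finset.range (2 ^ (j - s j)),
          |∑ N ∈ Finset.Ico (2 ^ j + i * 2 ^ s j) (2 ^ j + (i + 1) * 2 ^ s j),
            (ArithmeticFunction.liouville N : ℝ)|) ≤ η * 2 ^ j)
    (ψ : ℕ → ℕ) (hψ : Monotone ψ) (hψ' : Tendsto ψ atTop atTop) :
    ∀ ε : ℝ, 0 < ε → ∀ᶠ n : ℕ in atTop, ∀ G : ℕ → Bool,
      |∑ N ∈ Finset.range (2 ^ n), ((ArithmeticFunction.liouville N : ℤ) : ℝ) *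
          sgn (G (N / 2 ^ ψ n))| ≤ ε * (2 : ℝ) ^ n := by
  intro ε hε
  obtain ⟨L, hL⟩ := exists_pow_lt_of_lt_one (show (0 : ℝ) < ε / 4 by positivity)
    (show (1 / 2 : ℝ) < 1 by norm_num)
  obtain ⟨j₀, hj₀⟩ := Filter.eventually_atTop.mp (hBlocks (fun j => min (ψ j) j)
    (fun j => min_le_right _ _) (topDigits_tendsto_min hψ') (ε / 2) (by positivity))
  refine Filter.eventually_atTop.mpr ⟨j₀ + L, fun n hn G => ?_⟩
  have hLn : L ≤ n := le_of_add_le_right hn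
  set g : ℕ → ℝ := fun N => ((ArithmeticFunction.liouville N : ℤ) : ℝ) * sgn (G (N / 2 ^ ψ n))
    with hg
  have hg1 : ∀ N, |g N| ≤ 1 := by
    intro N
    have hsgn : |sgn (G (N / 2 ^ ψ n))| = 1 := by cases G (N / 2 ^ ψ n) <;> simp [sgn]
    rw [hg, abs_mul, hsgn, mul_one]
    exact abs_liouville_le_one N
  have h2n : (0 : ℝ) < 2 ^ n := by positivity
  -- split off the `2^{n-L}` lowest `N`
  have hsplit : ∑ N ∈ range (2 ^ n), g N
      = ∑ N ∈ Ico 0 (2 ^ (n - L)), g N + ∑ N ∈ Ico (2 ^ (n - L)) (2 ^ n), g N := by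
    rw [Finset.range_eq_Ico, Finset.sum_Ico_consecutive _ (Nat.zero_le _)
      (Nat.pow_le_pow_right two_pos (Nat.sub_le n L))]
  -- the low part: at most `2^{n-L} ≤ (ε/4) 2ⁿ` terms of modulus `≤ 1`
  have hlow : |∑ N ∈ Ico 0 (2 ^ (n - L)), g N| ≤ ε / 4 * 2 ^ n := by
    calc |∑ N ∈ Ico 0 (2 ^ (n - L)), g N|
        ≤ ∑ N ∈ Ico 0 (2 ^ (n - L)), |g N| := Finset.abs_sum_le_sum_abs _ _
      _ ≤ ∑ N ∈ Ico 0 (2 ^ (n - L)), (1 : ℝ) := Finset.sum_le_sum fun N _ => hg1 N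
      _ = (2 : ℝ) ^ (n - L) := by simp
      _ = (1 / 2 : ℝ) ^ L * 2 ^ n := by
        rw [← Nat.sub_add_cancel hLn, pow_add, Nat.add_sub_cancel, ← mul_assoc,
          mul_comm _ ((2 : ℝ) ^ L), ← mul_assoc, ← mul_pow]
        norm_num
      _ ≤ ε / 4 * 2 ^ n := mul_le_mul_of_nonneg_right hL.le h2n.le
  -- the high part: generations `j ∈ [n - L, n)`, each contributing at most `(ε/2) 2^j`
  have hhigh : |∑ N ∈ Ico (2 ^ (n - L)) (2 ^ n), g N| ≤ ε / 2 * 2 ^ n := by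
    rw [topDigits_sum_dyadic g (Nat.sub_le n L)]
    calc |∑ j ∈ Ico (n - L) n, ∑ N ∈ Ico (2 ^ j) (2 ^ (j + 1)), g N|
        ≤ ∑ j ∈ Ico (n - L) n, |∑ N ∈ Ico (2 ^ j) (2 ^ (j + 1)), g N| :=
          Finset.abs_sum_le_sum_abs _ _
      _ ≤ ∑ j ∈ Ico (n - L) n, ε / 2 * 2 ^ j := by
        refine Finset.sum_le_sum fun j hj => ?_
        rw [Finset.mem_Ico] at hj
        have hj0 : j₀ ≤ j := by omega
        have htT : min (ψ j) j ≤ ψ n := (min_le_left _ _).trans (hψ hj.2.le)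
        exact topDigits_generation G (min_le_right _ _) htT (hj₀ j hj0)
      _ = ε / 2 * (2 ^ n - 2 ^ (n - L)) := by
        rw [← Finset.mul_sum, topDigits_geom (Nat.sub_le n L)]
      _ ≤ ε / 2 * 2 ^ n := by
        have h2 : (0 : ℝ) ≤ 2 ^ (n - L) := by positivity
        nlinarith
  calc |∑ N ∈ range (2 ^ n), g N|
      = |∑ N ∈ Ico 0 (2 ^ (n - L)), g N + ∑ N ∈ Ico (2 ^ (n - L)) (2 ^ n), g N| := by rw [hsplit]
    _ ≤ |∑ N ∈ Ico 0 (2 ^ (n - L)), g N| + |∑ N ∈ Ico (2 ^ (n - L)) (2 ^ n), g N| := abs_add_le _ _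
    _ ≤ ε / 4 * 2 ^ n + ε / 2 * 2 ^ n := add_le_add hlow hhigh
    _ ≤ ε * (2 : ℝ) ^ n := by nlinarith

end Summit.QuantumAdvantage.QuantumAdvantage.Theorems.LiouvilleOrthogonalTC0

end
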